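import Literature.AlgebraicGeometry.AbelianSchemes.DualPairFibreDim
import Literature.AlgebraicGeometry.AbelianSchemes.PolarizationHatLevelStructure
import Literature.AlgebraicGeometry.AbelianSchemes.AbelianSchemeOverFibreDim
import Literature.AlgebraicGeometry.AbelianSchemes.AbelianSchemeOverCommOfReduced
import Literature.AlgebraicGeometry.AbelianSchemes.PolarizedAbelianSchemeWithLevelBaseChange
import Literature.AlgebraicGeometry.Motives.AbelianVarietyTorsionPointsCountProofs
import HarnessLib

/-!
# The level-`n` structure `(σᵢ^d ≫ λ)ᵢ` on the dual abelian scheme — unconditionally over a base locally of finite type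
# over a countable field of characteristic zero (the `hsurjn` binder of ★ `PolarizationHatLevelStructure` discharged)

Layer `Literature/AlgebraicGeometry/AbelianSchemes`, namespaces `Literature.AlgebraicGeometry.AbelianSchemes.AbelianSchemeOver`
(§1) and `Literature.AlgebraicGeometry.AbelianSchemes.PolarizedAbelianSchemeWithLevel` (§2–§3).
THEOREMS ONLY (no definition, no named fact, no instance, no `sorry`).

★ `PolarizationHatLevelStructure` ([MumfordFogartyKirwan1994] Ch. 7 §1 Def. 7.1 / App. 7A, [MumfordAV1970] §7 Thm. 4) builds
the level-`n` structure `(σᵢ^d ≫ λ)ᵢ` on the dual `Â` of a polarised abelian scheme with level-`N` structure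
`P = (A, λ, σ)` of type `δ`, `N = n·d`, `(∏ δᵢ, n) = 1`, MODULO the binder `hsurjn` «every `n`-torsion geometric fibre point of
`Â` is `x ≫ λ` for an `n`-torsion `x`».  This file discharges it by COUNTING:

* §1 `AbelianSchemeOver.natCard_fibrePoints_pow_eq_one` — `#{y ∈ X_s(Ω) | yⁿ = 1} = n^{2·dim X_s}` for a geometric point
  `s` with `n` invertible in `Ω` ([MumfordAV1970] §6 App. 3, ★ `AbelianVariety.natCard_torsionPoints_eq_of_isAlgClosed`,
  read in the `FibrePoints` currency through the partner dictionary of ★ `FibreHomPointsOfFibrePoints`, which is a bijection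
  respecting powers, ★ `fibrePointToLeft_pow`); `natCast_ne_zero_of_residueField` — `n` invertible on `S` ⇒ in `Ω`;
* §2 **`PolarizedAbelianSchemeWithLevel.torsionSurj_lam_of_dim_hat`** — `λ` is ONTO the `n`-torsion of the dual on every
  geometric fibre, GIVEN `dim Â_s = g` at geometric points: `x ↦ x ≫ λ` is injective on `A_s[n]` (★ §1 of
  `PolarizationHatLevelStructure`, `(∏ δᵢ, n) = 1`) between two sets of `n^{2g}` elements; hence
  `exists_hatLevelStructure_of_dim_hat` (★ `exists_hatLevelStructure_of_torsionSurj` with `hsurjn` discharged);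
* §3 **`exists_hatLevelStructure_of_locallyOfFiniteType`** — UNCONDITIONAL over a base `S → Spec F` locally of finite type
  with `F` countable of characteristic zero (e.g. the universal triple over the Siegel moduli scheme `𝓜.M → Spec ℚ`), where
  `dim Â_s = g` is ★ (D1) `Polarization.dim_hat_fibre_eq_of_locallyOfFiniteType` and `n ≠ 0` is invertible on `S`
  (`natCast_residueField_ne_zero_of_charZero`); and **`exists_hatLevelStructure_baseChange_of_locallyOfFiniteType`** — the
  same for every base change `P ×_S T` along any `w : T → S` (★ `DualPair.dim_hat_fibre_baseChange_eq`), the shape consumed on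
  the pull-back of the universal family to a piece of the moduli space.

Cell `hodgecm-mathlib` (D-0151), HECKE-LINK socket (B), brick (D2) (B-plan1 (g14) 22:16:52Z GO): the `φ : LevelStructure g n Â′`
input of ★ (K) `hStab_of_hChar` (B-p09 (g10)) in the Siegel situation, binder-free; count-neutral.  HC_CM is proved only modulo
the 7 printed citations until rung 0 closes.

## References
* [MumfordFogartyKirwan1994] D. Mumford, J. Fogarty, F. Kirwan, *GIT* 3rd ed. (1994), Ch. 7 §1 Def. 7.1 (p. 129), §2 Def. 7.2
  (p. 129), App. 7A (pp. 234–235); Ch. 6 §1 Def. 6.1 (p. 115).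
* [MumfordAV1970] D. Mumford, *Abelian Varieties* (1970), §6 Application 3 (Proposition p. 64), §7 Thm. 4 (p. 72), §13 Cor. 3
  (p. 130).
* [GortzWedhorn2020] U. Görtz, T. Wedhorn, *Algebraic Geometry I* (2nd ed., 2020), Section (4.7), (4.7.1) (p. 108).
-/

noncomputable section

universe u

open CategoryTheory CategoryTheory.Limits AlgebraicGeometry Cardinal

namespace Literature.AlgebraicGeometry.AbelianSchemes

namespace AbelianSchemeOver

open Literature.AlgebraicGeometry.Motives
open scoped MonObj

section Count

variable {S : Scheme.{u}} (B : AbelianSchemeOver S) {Ω : Type u} [Field Ω] (s : Spec (.of Ω) ⟶ S)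

/-! ### §1 The `n`-torsion of a geometric fibre in the `FibrePoints` currency has `n ^ (2 dim)` elements -/

/-- The partner `S`-point `(P̄, s)` of an `Ω`-point `P` of the fibre (★ `FibreHomPointsOfFibrePoints`) — as the term
`Over.homMk (fibrePointToLeft s P) _`; it is a BIJECTION onto `FibrePoints s` (★ `fibrePointToLeft_injective`, ★
`exists_points_fibrePointToLeft_eq`). [cite: GortzWedhorn2020, Section (4.7), (4.7.1) (p. 108)] -/
private theorem homMk_fibrePointToLeft_bijective :
    Function.Bijective fun P : (B.fibre s).toAbelianVariety.Points Ω =>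
      (Over.homMk (B.fibrePointToLeft s P) (B.fibrePointToLeft_comp_hom s P) : B.FibrePoints s) := by
  refine ⟨fun P Q h => B.fibrePointToLeft_injective s (congrArg (fun x => x.left) h), fun x => ?_⟩
  obtain ⟨P, hP⟩ := B.exists_points_fibrePointToLeft_eq s x
  exact ⟨P, Over.OverMorphism.ext hP⟩

/-- The partner map respects powers (★ `fibrePointToLeft_pow`). [cite: MumfordFogartyKirwan1994, Ch. 7 §2 Definition 7.2 (p. 129)] -/
private theorem homMk_fibrePointToLeft_pow (P : (B.fibre s).toAbelianVariety.Points Ω) (n : ℕ) :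
    (Over.homMk (B.fibrePointToLeft s (P ^ n)) (B.fibrePointToLeft_comp_hom s (P ^ n)) : B.FibrePoints s) =
      (Over.homMk (B.fibrePointToLeft s P) (B.fibrePointToLeft_comp_hom s P) : B.FibrePoints s) ^ n := by
  apply Over.OverMorphism.ext
  have e1 : ((Over.homMk (B.fibrePointToLeft s P) (B.fibrePointToLeft_comp_hom s P) : B.FibrePoints s) ^ n).left =
      (Over.homMk (B.fibrePointToLeft s P) (B.fibrePointToLeft_comp_hom s P) : B.FibrePoints s).left ≫
        ((𝟙 B.X : B.X ⟶ B.X) ^ n).left := by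
    rw [← Over.comp_left, MonObj.comp_pow, Category.comp_id]
  rw [e1]
  exact B.fibrePointToLeft_pow s P n

/-- The partner map respects units (★ `fibrePointToLeft_one_eq`). [cite: MumfordFogartyKirwan1994, Ch. 6 §1 Definition 6.1 (p. 115)] -/
private theorem homMk_fibrePointToLeft_one :
    (Over.homMk (B.fibrePointToLeft s 1) (B.fibrePointToLeft_comp_hom s 1) : B.FibrePoints s) = 1 :=
  Over.OverMorphism.ext (B.fibrePointToLeft_one_eq s)

/-- `n`-torsion corresponds under the partner map. [cite: MumfordFogartyKirwan1994, Ch. 7 §2 Definition 7.1 (p. 129)] -/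
private theorem homMk_fibrePointToLeft_pow_eq_one_iff (P : (B.fibre s).toAbelianVariety.Points Ω) (n : ℕ) :
    (Over.homMk (B.fibrePointToLeft s P) (B.fibrePointToLeft_comp_hom s P) : B.FibrePoints s) ^ n = 1 ↔ P ^ n = 1 := by
  rw [← homMk_fibrePointToLeft_pow, ← B.homMk_fibrePointToLeft_one s]
  exact (B.homMk_fibrePointToLeft_bijective s).1.eq_iff

/-- **`#{y ∈ X_s(Ω) | yⁿ = 1} = n ^ (2 · dim X_s)`** for a geometric point `s` with `n` invertible in `Ω` — the tree's count
★ `AbelianVariety.natCard_torsionPoints_eq_of_isAlgClosed` ([MumfordAV1970] §6 App. 3) read in the `FibrePoints` currency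
through the partner dictionary of ★ `FibreHomPointsOfFibrePoints` (which respects powers, ★ `fibrePointToLeft_pow`).
[cite: MumfordAV1970, §6 Application 3 (Proposition p. 64)] [cite: GortzWedhorn2020, Section (4.7), (4.7.1) (p. 108)] -/
theorem natCard_fibrePoints_pow_eq_one [IsAlgClosed Ω] (n : ℕ) (hn : (n : Ω) ≠ 0) :
    Nat.card {y : B.FibrePoints s // y ^ n = 1} = n ^ (2 * (B.fibre s).toAbelianVariety.dim) := by
  have hcount := (B.fibre s).toAbelianVariety.natCard_torsionPoints_eq_of_isAlgClosed Ω (n : ℤ)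
    (by exact_mod_cast hn)
  rw [Int.natAbs_natCast] at hcount
  rw [← hcount]
  symm
  refine Nat.card_congr (Equiv.ofBijective
    (fun P => ⟨Over.homMk (B.fibrePointToLeft s P.1) (B.fibrePointToLeft_comp_hom s P.1),
      (B.homMk_fibrePointToLeft_pow_eq_one_iff s P.1 n).2 ?_⟩) ⟨?_, ?_⟩)
  · have h := (AbelianVariety.mem_torsionPoints_iff (n : ℤ) P.1).1 P.2
    rwa [zpow_natCast] at h
  · intro P Q h
    exact Subtype.ext ((B.homMk_fibrePointToLeft_bijective s).1 (congrArg Subtype.val h))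
  · rintro ⟨y, hy⟩
    obtain ⟨P, rfl⟩ := (B.homMk_fibrePointToLeft_bijective s).2 y
    refine ⟨⟨P, (AbelianVariety.mem_torsionPoints_iff (n : ℤ) P).2 ?_⟩, rfl⟩
    rw [zpow_natCast]
    exact (B.homMk_fibrePointToLeft_pow_eq_one_iff s P n).1 hy

end Count

/-- `n` is invertible in the field of a field-valued point `s : Spec Ω → S` as soon as it is in the residue field of the
scheme point under `s` (the residue field maps to `Ω`, Mathlib `Scheme.descResidueField`) — the standing hypothesis «the
characteristics of the residue fields of all `s ∈ S` do not divide `n`» of [MumfordFogartyKirwan1994, Def. 7.1] read at a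
geometric point. [cite: MumfordFogartyKirwan1994, Ch. 7 §1 Definition 7.1 (p. 129)] -/
theorem natCast_ne_zero_of_residueField {S : Scheme.{u}} {Ω : Type u} [Field Ω] (s : Spec (.of Ω) ⟶ S) (n : ℕ)
    (hn : ∀ x : S, (n : S.residueField x) ≠ 0) : (n : Ω) ≠ 0 := by
  intro h
  apply hn (s (IsLocalRing.closedPoint Ω))
  have hinj := (S.descResidueField (Scheme.stalkClosedPointTo s)).hom.injective
  apply hinj
  rw [map_natCast, map_zero]
  exact h

end AbelianSchemeOver

/-! ### §2 `λ` is onto on `n`-torsion geometric fibre points; the level structure on `Â` -/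

namespace PolarizedAbelianSchemeWithLevel

open AbelianSchemeOver Literature.AlgebraicGeometry.Motives
open scoped MonObj

variable {S : Scheme.{u}} {g N : ℕ} {δ : Fin g → ℕ} (P : PolarizedAbelianSchemeWithLevel g N δ S)

/-- **`λ` is ONTO the `n`-torsion of the dual on every geometric fibre** — the `hsurjn` binder of ★
`exists_hatLevelStructure_of_torsionSurj` — for `(∏ δᵢ, n) = 1`, `n` invertible on `S`, and `dim Â_s = g` (★ (D1)
`Polarization.dim_hat_fibre_eq*`): `x ↦ x ≫ λ` maps `A_s[n](Ω)` to `Â_s[n](Ω)`, injectively (★ §1 of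
`PolarizationHatLevelStructure`), and both have `n^{2g}` elements (★ `natCard_fibrePoints_pow_eq_one`), so it is onto.
[cite: MumfordAV1970, §7 Thm. 4 (p. 72) and §6 Application 3 (p. 64)] [cite: MumfordFogartyKirwan1994, App. 7A (pp. 234–235)] -/
theorem torsionSurj_lam_of_dim_hat {n : ℕ} (hcop : Nat.Coprime (∏ i, δ i) n)
    (hn : ∀ x : S, (n : S.residueField x) ≠ 0)
    (hdim : ∀ ⦃Ω : Type u⦄ [Field Ω] [IsAlgClosed Ω] (s : Spec (.of Ω) ⟶ S),
      (P.D.hat.fibre s).toAbelianVariety.dim = g)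
    ⦃Ω : Type u⦄ [Field Ω] [IsAlgClosed Ω] (s : Spec (.of Ω) ⟶ S) (y : P.D.hat.FibrePoints s) (hy : y ^ n = 1) :
    ∃ x : P.A.FibrePoints s, x ^ n = 1 ∧ x ≫ P.pol.lam = y := by
  haveI := P.pol.isMonHom
  have hnΩ : (n : Ω) ≠ 0 := natCast_ne_zero_of_residueField s n hn
  -- `x ↦ x ≫ λ` on `n`-torsion
  let f : {x : P.A.FibrePoints s // x ^ n = 1} → {y : P.D.hat.FibrePoints s // y ^ n = 1} :=
    fun x => ⟨x.1 ≫ P.pol.lam, by rw [← MonObj.pow_comp, x.2, MonObj.one_comp]⟩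
  -- injective: the kernel of `λ` on `n`-torsion is trivial (`(∏ δᵢ, n) = 1`)
  have hinj : Function.Injective f := by
    rintro ⟨a, ha⟩ ⟨b, hb⟩ hab
    have hab' : a ≫ P.pol.lam = b ≫ P.pol.lam := congrArg Subtype.val hab
    have hq : (a * b⁻¹) ≫ P.pol.lam = 1 := by
      rw [MonObj.mul_comp, GrpObj.inv_comp, hab', mul_inv_cancel]
    have hc : Commute a b⁻¹ := FibrePoints.mul_comm (x := a) (y := b⁻¹)
    have hqn : (a * b⁻¹) ^ n = 1 := by
      rw [hc.mul_pow, inv_pow, ha, hb, inv_one, mul_one]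
    have hab1 : a * b⁻¹ = 1 :=
      Polarization.HasType.eq_one_of_pow_eq_one_of_comp_lam_eq_one P.hasType hcop s (a * b⁻¹) hqn hq
    exact Subtype.ext (mul_inv_eq_one.1 hab1)
  -- both sides have `n ^ (2 g)` elements
  have hn0 : n ≠ 0 := by
    rintro rfl
    exact hnΩ (by simp)
  have hA : Nat.card {x : P.A.FibrePoints s // x ^ n = 1} = n ^ (2 * g) := by
    rw [P.A.natCard_fibrePoints_pow_eq_one s n hnΩ, dim_fibre_of_isOfRelDim P.relDim s]
  have hB : Nat.card {y : P.D.hat.FibrePoints s // y ^ n = 1} = n ^ (2 * g) := by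
    rw [P.D.hat.natCard_fibrePoints_pow_eq_one s n hnΩ, hdim s]
  haveI : Finite {y : P.D.hat.FibrePoints s // y ^ n = 1} :=
    Nat.finite_of_card_ne_zero (by rw [hB]; exact pow_ne_zero _ hn0)
  obtain ⟨⟨x, hx⟩, hxy⟩ := (hinj.bijective_of_nat_card_le (hB.trans hA.symm).le).2 ⟨y, hy⟩
  exact ⟨x, hx, congrArg Subtype.val hxy⟩

/-- **The level-`n` structure `(σᵢ^d ≫ λ)ᵢ` on `Â` given `dim Â_s = g`** — ★ (u5) `exists_hatLevelStructure_of_torsionSurj`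
with its `hsurjn` binder DISCHARGED by `torsionSurj_lam_of_dim_hat`.
[cite: MumfordFogartyKirwan1994, Ch. 7 §1 Definition 7.1 (p. 129) and App. 7A (pp. 234–235)] [cite: MumfordAV1970, §7 Thm. 4 (p. 72)] -/
theorem exists_hatLevelStructure_of_dim_hat {n d : ℕ} (hd : N = n * d) (hN : N ≠ 0)
    (hcop : Nat.Coprime (∏ i, δ i) n) (hn : ∀ x : S, (n : S.residueField x) ≠ 0)
    (hdim : ∀ ⦃Ω : Type u⦄ [Field Ω] [IsAlgClosed Ω] (s : Spec (.of Ω) ⟶ S),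
      (P.D.hat.fibre s).toAbelianVariety.dim = g) :
    ∃ χ : P.D.hat.LevelStructure g n, ∀ i, χ.σ i = (P.level.changeLevel n d hd hN).σ i ≫ P.pol.lam :=
  P.exists_hatLevelStructure_of_torsionSurj hd hN hcop (P.torsionSurj_lam_of_dim_hat hcop hn hdim)

/-! ### §3 Unconditionally over a base locally of finite type over a countable field of characteristic zero -/

/-- Over a scheme mapping to `Spec F` with `F` of characteristic zero every residue field has characteristic zero (it is an
`F`-algebra), so a natural number `n ≠ 0` is invertible on the base — the standing hypothesis «the characteristics of the
residue fields of all `s ∈ S` do not divide `n`» of [MumfordFogartyKirwan1994, Def. 7.1] holds automatically over `ℚ`-schemes.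
[cite: MumfordFogartyKirwan1994, Ch. 7 §1 Definition 7.1 (p. 129)] -/
theorem natCast_residueField_ne_zero_of_charZero {S : Scheme.{u}} {F : Type u} [Field F] [CharZero F]
    (f : S ⟶ Spec (.of F)) (x : S) {n : ℕ} (hn : n ≠ 0) : (n : S.residueField x) ≠ 0 := by
  let c : F →+* S.residueField x :=
    (S.evaluation ⊤ x trivial).hom.comp (f.appTop.hom.comp (Scheme.ΓSpecIso (.of F)).inv.hom)
  haveI : CharZero (S.residueField x) := (RingHom.charZero_iff c.injective).mp inferInstance
  exact_mod_cast hn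

section FiniteType

variable {S T : Scheme.{0}} {g N : ℕ} {δ : Fin g → ℕ} (P : PolarizedAbelianSchemeWithLevel g N δ S)
  {F : Type} [Field F] [CharZero F]

/-- **The level-`n` structure `(σᵢ^d ≫ λ)ᵢ` on the dual `Â` — UNCONDITIONALLY** for a polarised abelian scheme with
level-`N` structure of type `δ`, `N = n·d`, `(∏ δᵢ, n) = 1`, over a base locally of finite type over a countable field of
characteristic zero (e.g. the universal triple over the Siegel moduli scheme `𝓜.M → Spec ℚ`): ★ (u5)
`exists_hatLevelStructure_of_torsionSurj` with `hsurjn` discharged by `torsionSurj_lam_of_dim_hat` and `dim Â_s = g` by ★ (D1)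
`Polarization.dim_hat_fibre_eq_of_locallyOfFiniteType`.  «`Â[n]` is CONSTANT, `= λ(A[n])`, spanned by the level sections.»
[cite: MumfordFogartyKirwan1994, Ch. 7 §1 Definition 7.1 (p. 129) and App. 7A (pp. 234–235)] [cite: MumfordAV1970, §7 Thm. 4 (p. 72) and §13 Cor. 3 (p. 130)] -/
theorem exists_hatLevelStructure_of_locallyOfFiniteType (hF : #F ≤ ℵ₀) (f : S ⟶ Spec (.of F)) [LocallyOfFiniteType f]
    {n d : ℕ} (hd : N = n * d) (hN : N ≠ 0) (hcop : Nat.Coprime (∏ i, δ i) n) :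
    ∃ χ : P.D.hat.LevelStructure g n, ∀ i, χ.σ i = (P.level.changeLevel n d hd hN).σ i ≫ P.pol.lam := by
  have hn0 : n ≠ 0 := by
    rintro rfl
    exact hN (by rw [hd, zero_mul])
  exact P.exists_hatLevelStructure_of_dim_hat hd hN hcop
    (fun x => natCast_residueField_ne_zero_of_charZero f x hn0)
    (fun Ω _ _ s => P.pol.dim_hat_fibre_eq_of_locallyOfFiniteType P.relDim hF f s)

/-- **The same for every base change `P ×_S T` along any `w : T → S`** (the pulled-back family over a piece of the moduli
space, e.g. the thick piece `S″ → 𝓜′` of the Hecke-link line): `dim` of the dual fibres transports along the chosen base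
change (★ `DualPair.dim_hat_fibre_baseChange_eq`) and `n` stays invertible (`T` is an `F`-scheme through `w`).
[cite: MumfordFogartyKirwan1994, Ch. 7 §1 Definition 7.1 (p. 129), §2 Definition 7.2 (p. 129) and App. 7A (pp. 234–235)]
[cite: MumfordAV1970, §7 Thm. 4 (p. 72) and §13 Cor. 3 (p. 130)] -/
theorem exists_hatLevelStructure_baseChange_of_locallyOfFiniteType (hF : #F ≤ ℵ₀) (f : S ⟶ Spec (.of F))
    [LocallyOfFiniteType f] (w : T ⟶ S) {n d : ℕ} (hd : N = n * d) (hN : N ≠ 0) (hcop : Nat.Coprime (∏ i, δ i) n) :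
    ∃ χ : (P.baseChange w).D.hat.LevelStructure g n,
      ∀ i, χ.σ i = ((P.baseChange w).level.changeLevel n d hd hN).σ i ≫ (P.baseChange w).pol.lam := by
  have hn0 : n ≠ 0 := by
    rintro rfl
    exact hN (by rw [hd, zero_mul])
  exact (P.baseChange w).exists_hatLevelStructure_of_dim_hat hd hN hcop
    (fun x => natCast_residueField_ne_zero_of_charZero (w ≫ f) x hn0)
    (fun Ω _ _ t => P.D.dim_hat_fibre_baseChange_eq w
      (fun Ω' _ s => P.pol.dim_hat_fibre_eq_of_locallyOfFiniteType P.relDim hF f s) t)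

end FiniteType

end PolarizedAbelianSchemeWithLevel

end Literature.AlgebraicGeometry.AbelianSchemes
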